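import Literature.AlgebraicGeometry.HodgeTheory.DworkSexticFlatPiecesHodgeRiemannTransport
import HarnessLib

/-!
# Purity of the flat `Γ_W`-pieces of the Dwork sextic of types `(1,2,3,3,4,5)`, `(1,1,2,4,5,5)`,
# `(1,1,3,3,5,5)` along an equivariant transport, granted the character of `H^{4,0}`

Family `hodge`, layer `Literature/AlgebraicGeometry/HodgeTheory`; theorems only (no definition, no
named fact; D-0026). Sequel to `DworkSexticFlatPiecesHodgeRiemannTransport`, whose theorem
`DworkSextic.eq_zero_of_mem_eigenspace_of_hodgePQ_three_one_of_transport` kills the `(3,1)`-part of a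
`Γ_W`-eigenspace `V_χ(X_ψ)` (`ψ⁶ ≠ 1`, `χ ≠ 1`, `V_χ(X⁴₆)` pure `(2,2)`) along an injective equivariant
real multiplicative transport `T : H⁴(X_ψ) → H⁴(X⁴₆)` fixing the ambient classes (Hodge–Riemann, Voisin I
Thm. 6.32). Written for crux K2 `FlatClassesSpannedByReflectionInvariants` (stmt-HodgeConjecture-20241)
of route `HodgeConjecture/DworkReflectionQuotients`. Here:

* `DworkSextic.pullback_mem_hodgePQ_two_two_of_transport` — **purity `(2,2)` of `V_χ(X_ψ)`** from the
  transport, the purity of `V_χ(X⁴₆)` and `V_{χ⁻¹}(X⁴₆)`, and the hypothesis that `H^{4,0}(X_ψ)` carries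
  only the trivial character of `Γ_W` (the `(4,0)`-parts; for the Calabi–Yau sextic
  `H^{4,0} = ℂ·Res(Ω/F_ψ)`, Griffiths' residues at pole order ONE — not proved here): the `(4,0)`- and
  `(3,1)`-parts of `V_χ`, `V_{χ⁻¹}` vanish and the tree's `pullback_mem_hodgePQ_half_of_eigenspace`
  concludes by conjugation;
* `DworkSextic.character_flatTypes_inv` — the characters of Katz's flat types are non-trivial and
  `χ_{e∘σ}⁻¹ = χ_{(6−e)∘σ}`;
* `DworkSextic.flatTypes_pullback_mem_hodgePQ_two_two_of_transport`,
  `DworkSextic.isOfHodgeType_two_two_flatTypes_of_transport` — **Katz's Lemma 3.1(2) at `ψ⁶ ≠ 1` for the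
  types `j = 0, 2, 3`** (`(1,2,3,3,4,5)`, `(1,1,2,4,5,5) ~ (1,2,2,4,4,5)`, `(1,1,3,3,5,5)`; 810 of the
  route's 1170 flat classes) from the transport and the `(4,0)`-statement, the Fermat end being the
  theorem `DworkSextic.fermat_flatTypes_gammaW_eigenspace_pullback_mem_hodgePQ_two_two`
  (`FermatSymmetricEigenlinesHodgeType`);
* `DworkSextic.flatClasses_mem_span_reflInvariant_of_transport` — the body of crux K2 for these three
  types under the same two hypotheses (six-reflection averaging, `mem_span_reflInvariant_of_isEig_add`).
  Compare `flatClasses_mem_span_reflInvariant_of_katz` / `…_of_griffiths` (all four types, each modulo a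
  named fact) and `flatClasses_mem_span_reflInvariant_singleton_of_rank_le_one` (`j = 0` modulo the
  transport alone). The type `j = 1`, `(1,2,2,3,5,5) ~ (1,1,3,4,4,5)`, is not symmetric at the Fermat
  point and is not covered.

## References

* [Katz2009] N. M. Katz, Another look at the Dwork family, Progr. Math. 270 (2009), Lemma 3.1 (proof),
  §2 pp. 5–7.
* [VoisinHodgeI2002] C. Voisin, Hodge Theory and Complex Algebraic Geometry I (2002), §6.3.2 Thm. 6.32,
  Cor. 6.12.
* [BiniGarbagnati2012] G. Bini, A. Garbagnati, Quotients of the Dwork pencil, J. Geom. Phys. 75 (2014),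
  §3.4.
-/

noncomputable section

open CategoryTheory MvPolynomial Finset
open scoped BigOperators

namespace Literature.AlgebraicGeometry.HodgeTheory

open Literature.AlgebraicGeometry.Motives Literature.AlgebraicTopology.SingularHomology
open Literature.Geometry.Kaehler

namespace DworkSextic

variable {ψ : ℂ}

/-- **Purity `(2,2)` of a `Γ_W`-piece of `X_ψ` along an equivariant transport, granted the vanishing
of its `(4,0)`-part.** With the transport data of
`eq_zero_of_mem_eigenspace_of_hodgePQ_three_one_of_transport`, suppose the eigenspaces of `χ` and
`χ⁻¹` in `H⁴(X⁴₆(ℂ); ℂ)` are of type `(2,2)` and that `H^{4,0}(X_ψ)` carries only the trivial character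
of `Γ_W` (every eigenclass of a non-trivial character with `A^* x ∈ H^{4,0}_A` vanishes — for the
Calabi–Yau sextic this is `H^{4,0} = ℂ·Res(Ω/F_ψ)`). Then `A^* V_χ(X_ψ) ⊆ H^{2,2}_A`: the `(4,0)`- and
`(3,1)`-parts of `V_χ` and `V_{χ⁻¹}` vanish, and the tree's `pullback_mem_hodgePQ_half_of_eigenspace`
concludes. [cite: Katz2009, Lemma 3.1(2)] [cite: VoisinHodgeI2002, §6.3.2 Thm. 6.32 and Cor. 6.12] -/
theorem pullback_mem_hodgePQ_two_two_of_transport (hψ : ψ ^ 6 ≠ 1)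
    (A : HodgeModel 4 (fibre ψ)) (A₀ : HodgeModel 4 (fermatHypersurface 4 6))
    {χ : gammaW →* ℂˣ} (hχ : χ ≠ 1)
    (hχF : ∀ c ∈ diagonalCharacterEigenspace (fermatPolynomial ℂ 4 6) gammaW χ (2 * 2),
      A₀.pullback (2 * 2) c ∈ A₀.hodgePQ (2 * 2) 2 2)
    (hχF' : ∀ c ∈ diagonalCharacterEigenspace (fermatPolynomial ℂ 4 6) gammaW χ⁻¹ (2 * 2),
      A₀.pullback (2 * 2) c ∈ A₀.hodgePQ (2 * 2) 2 2)
    (hZ : ∀ θ : gammaW →* ℂˣ, θ ≠ 1 → ∀ x ∈ diagonalCharacterEigenspace (form ψ) gammaW θ (2 * 2),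
      A.pullback (2 * 2) x ∈ A.hodgePQ (2 * 2) 4 0 → x = 0)
    (T : complexBetti (fibre ψ) (2 * 2) →ₗ[ℂ] complexBetti (fermatHypersurface 4 6) (2 * 2))
    (hTinj : Function.Injective T)
    (hTeq : ∀ (a : gammaW) (c : complexBetti (fibre ψ) (2 * 2)),
      T (singularCohomology.map ℂ ℂ (diagonalMap (form ψ) (gammaW_le_diagonalStabilizer ψ a.2)) (2 * 2) c) =
        singularCohomology.map ℂ ℂ
          (diagonalMap (fermatPolynomial ℂ 4 6) (gammaW_le_diagonalStabilizer_fermat a.2)) (2 * 2) (T c))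
    (hTconj : ∀ c, T (conjClass _ (2 * 2) c) = conjClass _ (2 * 2) (T c))
    (T' : complexBetti (fibre ψ) (2 * 4) →ₗ[ℂ] complexBetti (fermatHypersurface 4 6) (2 * 4))
    (hT' : ∀ x y : complexBetti (fibre ψ) (2 * 2),
      T' (cupProduct (by norm_num : 2 * 2 + 2 * 2 = 2 * 4) x y) =
        cupProduct (by norm_num : 2 * 2 + 2 * 2 = 2 * 4) (T x) (T y))
    (hTamb : ∀ θ : complexBetti (projectiveSpace (4 + 1) ℂ) (2 * 2),
      T (complexBetti.map (SmoothHypersurface.hypersurfaceι (form ψ)) (2 * 2) θ) =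
        complexBetti.map (SmoothHypersurface.hypersurfaceι (fermatPolynomial ℂ 4 6)) (2 * 2) θ)
    {c : complexBetti (fibre ψ) (2 * 2)} (hc : c ∈ diagonalCharacterEigenspace (form ψ) gammaW χ (2 * 2)) :
    A.pullback (2 * 2) c ∈ A.hodgePQ (2 * 2) 2 2 := by
  have hχ' : χ⁻¹ ≠ 1 := fun h => hχ (MonoidHom.ext fun a => by
    have ha := DFunLike.congr_fun h a
    rw [MonoidHom.inv_apply, MonoidHom.one_apply, inv_eq_one] at ha
    rw [ha, MonoidHom.one_apply])
  -- the upper types `(p,q)`, `q < p`, `p + q = 4`, are `(4,0)` and `(3,1)`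
  have hupper : ∀ (θ : gammaW →* ℂˣ), θ ≠ 1 →
      (∀ c ∈ diagonalCharacterEigenspace (fermatPolynomial ℂ 4 6) gammaW θ (2 * 2),
        A₀.pullback (2 * 2) c ∈ A₀.hodgePQ (2 * 2) 2 2) →
      ∀ i ∈ antidiagonal (2 * 2), i.2 < i.1 →
        ∀ x ∈ diagonalCharacterEigenspace (form ψ) gammaW θ (2 * 2),
          A.pullback (2 * 2) x ∈ A.hodgePQ (2 * 2) i.1 i.2 → x = 0 := by
    intro θ hθ hθF i hi hlt x hx hxA
    obtain ⟨p, q⟩ := i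
    have hsum : p + q = 2 * 2 := Finset.HasAntidiagonal.mem_antidiagonal.mp hi
    change q < p at hlt
    rcases (show (p = 4 ∧ q = 0) ∨ (p = 3 ∧ q = 1) by omega) with ⟨rfl, rfl⟩ | ⟨rfl, rfl⟩
    · exact hZ θ hθ x hx hxA
    · exact eq_zero_of_mem_eigenspace_of_hodgePQ_three_one_of_transport hψ A A₀ hθ hθF T hTinj hTeq
        hTconj T' hT' hTamb hx hxA
  exact pullback_mem_hodgePQ_half_of_eigenspace (form ψ) (gammaW_le_diagonalStabilizer ψ) χ
    (isSmoothProjective_fibre hψ) A (hupper χ hχ hχF) (hupper χ⁻¹ hχ' hχF') hc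

/-- The characters of Katz's flat types are non-trivial, and the inverse of the character of `e ∘ σ`
is that of the conjugate type `(6 − e) ∘ σ` (and vice versa): `5e ≡ 6 − e (mod 6)` coordinatewise.
[cite: Katz2009, Lemma 3.1 and §2 p. 5] -/
theorem character_flatTypes_inv (j : Fin 4) (σ : Equiv.Perm (Fin 6)) :
    character (fun l => flatTypes j (σ l)) ≠ 1 ∧ character (fun l => 6 - flatTypes j (σ l)) ≠ 1 ∧
    (character (fun l => flatTypes j (σ l)))⁻¹ = character (fun l => 6 - flatTypes j (σ l)) ∧
    (character (fun l => 6 - flatTypes j (σ l)))⁻¹ = character (fun l => flatTypes j (σ l)) := by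
  obtain ⟨h1, -, h3, -⟩ := flatTypes_translate_lower j
  have hmod : ∀ m : Fin 6, 5 * flatTypes j m % 6 = (6 - flatTypes j m) % 6 ∧
      5 * (6 - flatTypes j m) % 6 = flatTypes j m % 6 := by
    fin_cases j <;> decide
  refine ⟨character_ne_one (translate_lower_comp_equiv h1 σ), character_ne_one (translate_lower_comp_equiv h3 σ),
    ?_, ?_⟩
  · rw [character_inv]
    exact character_eq_of_mod_eq fun k => (hmod (σ k)).1
  · rw [character_inv]
    exact character_eq_of_mod_eq fun k => (hmod (σ k)).2

/-- **Katz's flat types `j = 0, 2, 3` along an equivariant transport**: for `ψ⁶ ≠ 1`, a Hodge model `A`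
of `X_ψ`, `σ ∈ 𝔖₆`, the transport data `T`, `T'` (injective, `Γ_W`-equivariant, real, multiplicative,
fixing the ambient classes) and the triviality of the `Γ_W`-character of `H^{4,0}(X_ψ)`, the
`Γ_W`-eigenspaces of `χ_{e∘σ}` and `χ_{(6−e)∘σ}` in `H⁴(X_ψ(ℂ); ℂ)`, `e = flatTypes j`, are of type
`(2,2)` — the Fermat end being the theorem
`fermat_flatTypes_gammaW_eigenspace_pullback_mem_hodgePQ_two_two`. This is Katz's Lemma 3.1(2) for
these types with Griffiths' pole-order-two input replaced by the transport and the `(4,0)`-statement.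
[cite: Katz2009, Lemma 3.1(2)] [cite: VoisinHodgeI2002, §6.3.2 Thm. 6.32] -/
theorem flatTypes_pullback_mem_hodgePQ_two_two_of_transport (hψ : ψ ^ 6 ≠ 1) (j : Fin 4) (hj : j ≠ 1)
    (σ : Equiv.Perm (Fin 6)) (A : HodgeModel 4 (fibre ψ))
    (hZ : ∀ θ : gammaW →* ℂˣ, θ ≠ 1 → ∀ x ∈ diagonalCharacterEigenspace (form ψ) gammaW θ (2 * 2),
      A.pullback (2 * 2) x ∈ A.hodgePQ (2 * 2) 4 0 → x = 0)
    (T : complexBetti (fibre ψ) (2 * 2) →ₗ[ℂ] complexBetti (fermatHypersurface 4 6) (2 * 2))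
    (hTinj : Function.Injective T)
    (hTeq : ∀ (a : gammaW) (c : complexBetti (fibre ψ) (2 * 2)),
      T (singularCohomology.map ℂ ℂ (diagonalMap (form ψ) (gammaW_le_diagonalStabilizer ψ a.2)) (2 * 2) c) =
        singularCohomology.map ℂ ℂ
          (diagonalMap (fermatPolynomial ℂ 4 6) (gammaW_le_diagonalStabilizer_fermat a.2)) (2 * 2) (T c))
    (hTconj : ∀ c, T (conjClass _ (2 * 2) c) = conjClass _ (2 * 2) (T c))
    (T' : complexBetti (fibre ψ) (2 * 4) →ₗ[ℂ] complexBetti (fermatHypersurface 4 6) (2 * 4))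
    (hT' : ∀ x y : complexBetti (fibre ψ) (2 * 2),
      T' (cupProduct (by norm_num : 2 * 2 + 2 * 2 = 2 * 4) x y) =
        cupProduct (by norm_num : 2 * 2 + 2 * 2 = 2 * 4) (T x) (T y))
    (hTamb : ∀ θ : complexBetti (projectiveSpace (4 + 1) ℂ) (2 * 2),
      T (complexBetti.map (SmoothHypersurface.hypersurfaceι (form ψ)) (2 * 2) θ) =
        complexBetti.map (SmoothHypersurface.hypersurfaceι (fermatPolynomial ℂ 4 6)) (2 * 2) θ) :
    (∀ c ∈ diagonalCharacterEigenspace (form ψ) gammaW (character fun l => flatTypes j (σ l)) (2 * 2),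
        A.pullback (2 * 2) c ∈ A.hodgePQ (2 * 2) 2 2) ∧
    (∀ c ∈ diagonalCharacterEigenspace (form ψ) gammaW (character fun l => 6 - flatTypes j (σ l)) (2 * 2),
        A.pullback (2 * 2) c ∈ A.hodgePQ (2 * 2) 2 2) := by
  obtain ⟨A₀⟩ := nonempty_hodgeModel_holds (n := 4) (X := fermatHypersurface 4 6)
    (isSmoothProjective_fermatHypersurface (by norm_num) (by norm_num))
  obtain ⟨hF, hF'⟩ := fermat_flatTypes_gammaW_eigenspace_pullback_mem_hodgePQ_two_two j hj σ A₀
  obtain ⟨hne, hne', hinv, hinv'⟩ := character_flatTypes_inv j σ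
  refine ⟨fun c hc => pullback_mem_hodgePQ_two_two_of_transport hψ A A₀ hne hF (hinv ▸ hF') hZ T hTinj hTeq
      hTconj T' hT' hTamb hc,
    fun c hc => pullback_mem_hodgePQ_two_two_of_transport hψ A A₀ hne' hF' (hinv' ▸ hF) hZ T hTinj hTeq
      hTconj T' hT' hTamb hc⟩

/-- `IsEig` / `IsOfHodgeType` form of `flatTypes_pullback_mem_hodgePQ_two_two_of_transport`: under the
same hypotheses (the `(4,0)`-statement now for every Hodge model), eigenclasses of the types
`e ∘ σ` and `(6 − e) ∘ σ`, `e = flatTypes j`, `j ≠ 1`, are `IsOfHodgeType 4 X_ψ 4 2 2`.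
[cite: Katz2009, Lemma 3.1(2)] -/
theorem isOfHodgeType_two_two_flatTypes_of_transport (hψ : ψ ^ 6 ≠ 1) (j : Fin 4) (hj : j ≠ 1)
    (σ : Equiv.Perm (Fin 6))
    (hZ : ∀ (A : HodgeModel 4 (fibre ψ)) (θ : gammaW →* ℂˣ), θ ≠ 1 →
      ∀ x ∈ diagonalCharacterEigenspace (form ψ) gammaW θ (2 * 2),
        A.pullback (2 * 2) x ∈ A.hodgePQ (2 * 2) 4 0 → x = 0)
    (T : complexBetti (fibre ψ) (2 * 2) →ₗ[ℂ] complexBetti (fermatHypersurface 4 6) (2 * 2))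
    (hTinj : Function.Injective T)
    (hTeq : ∀ (a : gammaW) (c : complexBetti (fibre ψ) (2 * 2)),
      T (singularCohomology.map ℂ ℂ (diagonalMap (form ψ) (gammaW_le_diagonalStabilizer ψ a.2)) (2 * 2) c) =
        singularCohomology.map ℂ ℂ
          (diagonalMap (fermatPolynomial ℂ 4 6) (gammaW_le_diagonalStabilizer_fermat a.2)) (2 * 2) (T c))
    (hTconj : ∀ c, T (conjClass _ (2 * 2) c) = conjClass _ (2 * 2) (T c))
    (T' : complexBetti (fibre ψ) (2 * 4) →ₗ[ℂ] complexBetti (fermatHypersurface 4 6) (2 * 4))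
    (hT' : ∀ x y : complexBetti (fibre ψ) (2 * 2),
      T' (cupProduct (by norm_num : 2 * 2 + 2 * 2 = 2 * 4) x y) =
        cupProduct (by norm_num : 2 * 2 + 2 * 2 = 2 * 4) (T x) (T y))
    (hTamb : ∀ θ : complexBetti (projectiveSpace (4 + 1) ℂ) (2 * 2),
      T (complexBetti.map (SmoothHypersurface.hypersurfaceι (form ψ)) (2 * 2) θ) =
        complexBetti.map (SmoothHypersurface.hypersurfaceι (fermatPolynomial ℂ 4 6)) (2 * 2) θ)
    {u v : complexBetti (fibre ψ) (2 * 2)}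
    (hu : IsEig ψ (fun l => flatTypes j (σ l)) u) (hv : IsEig ψ (fun l => 6 - flatTypes j (σ l)) v) :
    IsOfHodgeType 4 (fibre ψ) (2 * 2) 2 2 u ∧ IsOfHodgeType 4 (fibre ψ) (2 * 2) 2 2 v := by
  obtain ⟨A⟩ := nonempty_hodgeModel_holds (n := 4) (X := fibre ψ) (isSmoothProjective_fibre hψ)
  obtain ⟨h1, h2⟩ := flatTypes_pullback_mem_hodgePQ_two_two_of_transport hψ j hj σ A (hZ A) T hTinj hTeq
    hTconj T' hT' hTamb
  exact ⟨⟨A, h1 _ (mem_eigenspace_of_isEig hu)⟩, ⟨A, h2 _ (mem_eigenspace_of_isEig hv)⟩⟩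

/-- **Crux K2 for the types `(1,2,3,3,4,5)`, `(1,1,2,4,5,5)`, `(1,1,3,3,5,5)`, granted the equivariant
transport and the triviality of the character of `H^{4,0}(X_ψ)`** (instead of Katz's / Griffiths'
pole-order-two facts): for `ψ⁶ ≠ 1`, `j ≠ 1`, `σ ∈ 𝔖₆` and every RATIONAL class `w = u + v` with `u`
an eigenclass of exponent `e ∘ σ` and `v` one of exponent `(6 − e) ∘ σ`, `e = flatTypes j`, the class
`w` lies in the `ℂ`-span of the rational `(2,2)`-classes fixed by a realised reflection `s_(i,i',ζ)`
(`isOfHodgeType_two_two_flatTypes_of_transport` and the six-reflection averaging identity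
`mem_span_reflInvariant_of_isEig_add`). Compare `flatClasses_mem_span_reflInvariant_of_griffiths`
(all four types, conditional on Griffiths' named fact). [cite: Katz2009, Lemma 3.1 and §2 pp. 5–7]
[cite: BiniGarbagnati2012, §3.4] -/
theorem flatClasses_mem_span_reflInvariant_of_transport (hψ : ψ ^ 6 ≠ 1) (j : Fin 4) (hj : j ≠ 1)
    (σ : Equiv.Perm (Fin 6))
    (hZ : ∀ (A : HodgeModel 4 (fibre ψ)) (θ : gammaW →* ℂˣ), θ ≠ 1 →
      ∀ x ∈ diagonalCharacterEigenspace (form ψ) gammaW θ (2 * 2),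
        A.pullback (2 * 2) x ∈ A.hodgePQ (2 * 2) 4 0 → x = 0)
    (T : complexBetti (fibre ψ) (2 * 2) →ₗ[ℂ] complexBetti (fermatHypersurface 4 6) (2 * 2))
    (hTinj : Function.Injective T)
    (hTeq : ∀ (a : gammaW) (c : complexBetti (fibre ψ) (2 * 2)),
      T (singularCohomology.map ℂ ℂ (diagonalMap (form ψ) (gammaW_le_diagonalStabilizer ψ a.2)) (2 * 2) c) =
        singularCohomology.map ℂ ℂ
          (diagonalMap (fermatPolynomial ℂ 4 6) (gammaW_le_diagonalStabilizer_fermat a.2)) (2 * 2) (T c))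
    (hTconj : ∀ c, T (conjClass _ (2 * 2) c) = conjClass _ (2 * 2) (T c))
    (T' : complexBetti (fibre ψ) (2 * 4) →ₗ[ℂ] complexBetti (fermatHypersurface 4 6) (2 * 4))
    (hT' : ∀ x y : complexBetti (fibre ψ) (2 * 2),
      T' (cupProduct (by norm_num : 2 * 2 + 2 * 2 = 2 * 4) x y) =
        cupProduct (by norm_num : 2 * 2 + 2 * 2 = 2 * 4) (T x) (T y))
    (hTamb : ∀ θ : complexBetti (projectiveSpace (4 + 1) ℂ) (2 * 2),
      T (complexBetti.map (SmoothHypersurface.hypersurfaceι (form ψ)) (2 * 2) θ) =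
        complexBetti.map (SmoothHypersurface.hypersurfaceι (fermatPolynomial ℂ 4 6)) (2 * 2) θ)
    (w : complexBetti (fibre ψ) (2 * 2)) (hrat : IsRationalClass w)
    (huv : ∃ u v : complexBetti (fibre ψ) (2 * 2), IsEig ψ (fun l => flatTypes j (σ l)) u ∧
      IsEig ψ (fun l => 6 - flatTypes j (σ l)) v ∧ w = u + v) :
    w ∈ Submodule.span ℂ {c : complexBetti (fibre ψ) (2 * 2) | IsRationalClass c ∧
      IsOfHodgeType 4 (fibre ψ) (2 * 2) 2 2 c ∧ ∃ i i' : Fin 6, i ≠ i' ∧ ∃ ζ : ℂ, ζ ^ 6 = 1 ∧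
        ∃ g : C(Motives.ComplexPoints (fibre ψ), Motives.ComplexPoints (fibre ψ)),
          (∀ x, ∃ t : ℂ, (pt ψ (g x)).rep = t • (fun k => if k = i then ζ * (pt ψ x).rep i'
            else if k = i' then ζ⁻¹ * (pt ψ x).rep i else (pt ψ x).rep k)) ∧
          singularCohomology.map ℂ ℂ g (2 * 2) c = c} := by
  obtain ⟨u, v, hu, hv, hw⟩ := huv
  obtain ⟨hne, hne'⟩ := flatTypes_zero_ne_five j
  obtain ⟨hu2, hv2⟩ := isOfHodgeType_two_two_flatTypes_of_transport hψ j hj σ hZ T hTinj hTeq hTconj T' hT'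
    hTamb hu hv
  have hij : σ.symm 0 ≠ σ.symm 5 := fun h => by simpa using congrArg σ h
  exact mem_span_reflInvariant_of_isEig_add hψ hij (e := fun l => flatTypes j (σ l))
    (e' := fun l => 6 - flatTypes j (σ l)) (by simpa using hne) (by simpa using hne') hu hv hw hrat
    (hw ▸ hu2.add (isSmoothProjective_fibre hψ) hv2)

end DworkSextic

end Literature.AlgebraicGeometry.HodgeTheory

end
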